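import Summits.Ventures.CertifiedManyBodySolver.Observables.MeanFieldClassExclusionObjectEYbco106
import Literature.MathematicalPhysics.QuantumLattice.HubbardFermiSeaTangentRowsDeepColumns
import Literature.MathematicalPhysics.QuantumLattice.HubbardFermiSeaTangentRowsBoxEnds
import Literature.MathematicalPhysics.QuantumLattice.HubbardFermiSeaTangentRowsLow
import Literature.MathematicalPhysics.QuantumLattice.HubbardFermiSeaTangentRowsLowB
import Literature.MathematicalPhysics.QuantumLattice.HubbardFermiSeaTangentRowsLscoColumns
import Summits.Ventures.CertifiedManyBodySolver.Observables.MeanFieldClassExclusionPolarisedCapTlCcoc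
import Summits.Ventures.CertifiedManyBodySolver.Certificates.HubbardSquare_afhfCap_n1_U5
import Summits.Ventures.CertifiedManyBodySolver.Certificates.HubbardSquare_afhfCap_n1_U6
import Summits.Ventures.CertifiedManyBodySolver.Certificates.HubbardSquare_afhfCap_n1_U7
import HarnessLib

/-!
# Ventures/CertifiedManyBodySolver — Observables/MeanFieldClassExclusionPolarisedCapV2TlYbco.lean

HONEST FRAMING: first certified bounds; not a superconductivity verdict; every number certified or labelled float.
A competing-order EXCLUSION removes a named class of candidate ground states; it never says which order is present;
no phase sentence follows.

Cell `hubbard-tc` (MO-S3, D-0096), seat `hubbard-tc-mod-3` (G3: competing orders as exclusion inputs from certified energy ORDERINGS),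
`prover-hubbard-tc-mod-3-g6-0`. **UNCONDITIONAL EDITIONS, round 2 (`_v2`: polarised-sea ∧ AF-Hartree–Fock caps)** of the registry's MF/BCS-class exclusion words on the Tl₂Ba₂CuO₆₊δ hold-out #56 face (34a, 34b; `[3.19, 8.20] × [−0.425, −0.324]`) and the YBa₂Cu₃O₆.₉₂ BOX OF RECORD #106 object-E face (`t' ∈ [−13/20, −21/50]`, three filling bands).
The earlier words (`MeanFieldClassExclusionObjectE{,2,Hg,Hg1223,Tl2201}.lean`, `…LaLowU(B).lean`, …) take mbsolver claim nodes (#445, #473, #472, #498,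
#21) as hypotheses because their CAPS are transported certified anchors. Round 1 (`…PolarisedCap*.lean`) capped with the fully POLARISED one-species grid-cell Fermi sea — a
`U`-independent Slater determinant whose energy plane `e₀(1, s, U, n_j) ≤ A_j + s·B_j` is certified IN THE KERNEL by the tree's
`TTPrimeFree.polarizedPlaneCheck` (file `HubbardTTPrimePolarizedSeaCapTable`, the device behind hubbard-box-p2's sandwich words; `M = 40`, interval
enclosures of the cell-averaged cosines, `decide +kernel`). On hole-doped faces with `t' ≲ −0.2` this cap lies `0.2–0.4·t` BELOW the transported
anchors, so the docc tail closes at the Stoner-type threshold `U₁ = (e_pol − e_free)/(n/2)²` — LOWER than before — and WITHOUT any claim node: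
a non-magnetic Hartree–Fock / singlet-BCS state has energy `≥ e_free + U(n/2)²` (Wick; Bach–Lieb–Solovej 1994 §2), the ground state has energy
`≤ e_pol` at every `U`, and concavity in `U` gives `docc_GS ≤ (e_pol − e_free)/U`.

Every word: for the stated `t'`-range (⊇ the S1 box of record), EVERY `U ≥ U₁` and the stated filling band (⊇ the box band, ends on the
`1/1600` grid of the certificate), every torus limit `ω` of unit `(rectN n L, S^z = 0)`-sector ground states of `hubbardTorusTT' L 1 t' U` has
`Re ω(n_{0↑} n_{0↓}) < (n/2)²` (the identification «no HF/BCS ground state» is the docstring's reading; the THEOREM is the strict docc inequality):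

* `tlP_opt_docc_lt_v2` — Tl₂Ba₂CuO₆₊δ optimally doped (VSET 34a, hold-out #56), object E `[3.19, 8.20] × [−0.425, −0.324] × [0.80, 0.88]`: `t' ∈ [-17/40, -81/250]` × `n ∈ [4/5, 22/25]`, EVERY `U ≥ 5` (box `[3.19, 8.20]`; before: `tlP_opt_docc_lt (round 1) ⊂ tlE_opt_docc_lt_of (U ≥ 6.25; #445 ∧ #473 ∧ #472)`);
* `tlP_od26_docc_lt_v2` — Tl₂Ba₂CuO₆₊δ overdoped p = 0.26 (VSET 34b), object E, `n ∈ [0.70, 0.78]`: `t' ∈ [-17/40, -81/250]` × `n ∈ [7/10, 39/50]`, EVERY `U ≥ 9/2` (box `[3.19, 8.20]`; before: `tlP_od26_docc_lt (round 1) ⊂ tlE_od26_docc_lt_of (U ≥ 7.5; #445 ∧ #473)`);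
* `ybco106E_highBand_docc_lt_v2` — YBa₂Cu₃O₆.₉₂ BOX OF RECORD #106 object E (M18; P = 0 `[4.7, 11.4] × [−0.63, −0.44]`, P = 2 GPa `[4.4, 12.0] × [−0.65, −0.42]`, `n(plane) ∈ [0.81, 0.92]`): `t' ∈ [-13/20, -21/50]` × `n ∈ [7/8, 23/25]`, EVERY `U ≥ 11/2` (box `@0 [4.7, 11.4] / @2 [4.4, 12.0]`; before: `ybco106E_highBand_docc_lt (round 1) ⊂ U ≥ 6`);
* `ybco106E_lowBand_docc_lt_v2` — YBa₂Cu₃O₆.₉₂ BOX OF RECORD #106 object E (M18; P = 0 `[4.7, 11.4] × [−0.63, −0.44]`, P = 2 GPa `[4.4, 12.0] × [−0.65, −0.42]`, `n(plane) ∈ [0.81, 0.92]`): `t' ∈ [-13/20, -21/50]` × `n ∈ [81/100, 7/8]`, EVERY `U ≥ 24/5` (box `@0 [4.7, 11.4] / @2 [4.4, 12.0]`; before: `ybco106E_lowBand_docc_lt (round 1) ⊂ U ≥ 11/2`);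
* `ybco106E_lowN_docc_lt_v2` — YBa₂Cu₃O₆.₉₂ BOX OF RECORD #106 object E (M18; P = 0 `[4.7, 11.4] × [−0.63, −0.44]`, P = 2 GPa `[4.4, 12.0] × [−0.65, −0.42]`, `n(plane) ∈ [0.81, 0.92]`): `t' ∈ [-13/20, -21/50]` × `n ∈ [79/100, 81/100]`, EVERY `U ≥ 23/5` (box `@0 [4.7, 11.4] / @2 [4.4, 12.0]`; before: `ybco106E_lowN_docc_lt (round 1) ⊂ U ≥ 24/5`);

Round 2 adds hubbard-box-p2's KERNEL-CHECKED antiferromagnetic Hartree–Fock cap planes at HALF FILLING (`afhfCap_n1_U5/U6/U7_at`: `e₀(1, t', U, 1) ≤ C_{U_c}` for every `t'` and every `U ≤ U_c`, `QFK.Cert` certificates, no hypothesis): the density chord from the polarised plane at the band's LOWER end to the AF-HF cap at `n = 1` (or, next to half filling, the vacuum chord `n·C_{U_c}`) is a far lower cap at the band's TOP than the polarised plane there, and the tail runs with `U_c ∈ {5, 6, 7}` (cap monotone in `U` below `U_c`, Hartree–Fock Lipschitz slope `(n/2)²` above — `doccN_lt_of_capUc_threshold`; thresholds `≤ U_c`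 by construction). Proof otherwise as round 1: CAP chord (`objE_capChord_mul`, convexity in `n`); FLOOR = kernel Fermi-sea tangent rows (cell-exact,
`HubbardFermiSeaTangentRows*`) at columns bracketing the box, read between columns by the `t'`-chord (`objE_floorChord_mul`, concavity in `t'`);
TAIL = `doccN_lt_of_capUc_threshold` with `U_c := U`; `(n/2)²` above its tangent at the band's lower end. Cap chord, floor chord and tangent are
bilinear in `(n, t')`: one `nlinarith` leaf per column piece with the four McCormick products of its rectangle (corner-exact). Exact margins
(designer `hubbard-tc-mod-3/g6-replay/editions/`, exact rationals on the tree constants) are printed in each docstring; binding corners sit at the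
TOP filling and the SHALLOW `t'` end (the polarisation cost grows with `n` and toward `t' = 0`). The conditional words remain true and cited; these
editions supersede them for box coverage. NEW COVERAGE: Tl 34a from 5.0 (round 1: 5.7), 34b from 4.5 (4.9); YBa₂Cu₃O₆.₉₂ #106 high band `[7/8, 0.92]` from 4.8 (round 1: 6), band `[0.81, 7/8]` from 4.6 (5.5), annex from 4.6 (4.8) ⇒ the P = 0 box `[4.7, 11.4]` is covered from 4.8 / 4.7 / 4.7 (the face word of record stays `ybco106E_docc_lt` (U ≥ 6) until the lead re-reads).
WHAT THIS IS NOT: a statement about stripes/CDW, d-wave order or T_c; a claim that the ground state is polarised anywhere; tight; a phase word.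

References: Bach–Lieb–Solovej, J. Stat. Phys. 76 (1994) 3, eq. (2c.36) [BachLiebSolovej1994]; Koma–Tasaki, J. Stat. Phys. 76 (1994) 745, §1 [KomaTasaki1994];
Lieb–Loss, Duke Math. J. 71 (1993) 337, §8 Thm 8.2 [LiebLoss1993]; Israel (1979) Thm I.3.4 [Israel1979]; Ruelle (1969) §3.3 [Ruelle1969]; Neumaier, Acta Numerica 13 (2004) §11 [Neumaier2004CompleteSearch].
-/

noncomputable section

namespace Summit.Ventures.CertifiedManyBodySolver.Observables

open Literature.MathematicalPhysics.QuantumLattice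
open Literature.MathematicalPhysics.QuantumLattice.ThermodynamicLimit
open Literature.MathematicalPhysics.QuantumLattice.TTPrimeFree
open Summit.Ventures.CertifiedManyBodySolver.Certificates
open Matrix HubbardWave0 Literature.Probability.LatticeModels Filter Topology Set
open scoped ComplexOrder BigOperators

/-! ### §1 (no new certificates: the polarised-sea planes of round 1 are imported; the AF-Hartree–Fock half-filling caps are hubbard-box-p2's `afhfCap_n1_U5/U6/U7_at`) -/
/-! ### §2 The words (cap chord in `n`, floor chords in `t'`, one McCormick leaf per column piece; tail with `U_c := U`) -/
/-- **Tl₂Ba₂CuO₆₊δ optimally doped (VSET 34a, hold-out #56), object E `[3.19, 8.20] × [−0.425, −0.324] × [0.80, 0.88]`, `t' ∈ [-17/40, -81/250]` × `n ∈ [4/5, 22/25]` — MF/BCS class excluded at EVERY `U ≥ 5`, HYPOTHESIS-FREE** (box `U/t_eff ∈ [3.19, 8.20]`; supersedes for coverage the conditional `tlP_opt_docc_lt (round 1) ⊂ tlE_opt_docc_lt_of (U ≥ 6.25; #445 ∧ #473 ∧ #472)`). Every GS torus limit has `Re ω(n_{0↑}n_{0↓}) < (n/2)²`. Cap at `U_c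 = 5` = density chord from the polarised-sea plane at `n = 4/5` to the kernel AF-HF half-filling cap `afhfCap_n1_U5_at` (tail: monotone below `U_c`, HF slope above); floor = `t'`-chords of the kernel Fermi-sea columns `-9/20 | -7/20 | -3/10` (touch `7/8 | 7/8 | 7/8`); exact piece margins `+0.0253`, `+0.0121`. [cite: BachLiebSolovej1994, eq. (2c.36)] [cite: KomaTasaki1994, §1] [cite: LiebLoss1993, §8, Theorem 8.2] -/
theorem tlP_opt_docc_lt_v2 {t' U n : ℝ} (ht1 : -17 / 40 ≤ t') (ht2 : t' ≤ -81 / 250) (hU : 5 ≤ U)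
    (hn1 : 4 / 5 ≤ n) (hn2 : n ≤ 22 / 25) :
    ∀ (ω : InfVolFermionState 2) (Ls : ℕ → ℕ) (ψ : ∀ L, Fock (Orb (FermionTorus 2 L))),
      Tendsto Ls atTop atTop →
      (∀ j, IsGroundStateInSector (hubbardTorusTT' (Ls j) 1 t' U) (rectN n (Ls j)) 0 (ψ (Ls j))) →
      (∀ j, star (ψ (Ls j)) ⬝ᵥ ψ (Ls j) = 1) → ω.IsTorusLimitOf ψ Ls →
      (ω.expect ({0} : Finset (Site 2))
        (nAt 0 (Finset.mem_singleton_self 0) 0 * nAt 0 (Finset.mem_singleton_self 0) 1)).re < (n / 2) ^ 2 := by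
  have hn0 : (0 : ℝ) ≤ n := by linarith
  have hn2' : n < 2 := by linarith
  have hsq : (-4 / 25 : ℝ) + 2 / 5 * n ≤ (n / 2) ^ 2 := by nlinarith [sq_nonneg (n - 4 / 5)]
  have hsqU : ((-4 / 25 : ℝ) + 2 / 5 * n) * (5) ≤ (n / 2) ^ 2 * (5) :=
    mul_le_mul_of_nonneg_right hsq (by norm_num)
  -- CAP at `U_c = 5`: density chord from the polarised-sea plane at `n = 4/5` to the kernel AF-Hartree–Fock half-filling cap
  have ca := tlP34a_polCap_n8000 (by norm_num : (0 : ℝ) ≤ 5) ht1 ht2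
  have cb := afhfCap_n1_U5_at t' (by norm_num : (0 : ℝ) ≤ 5) le_rfl
  have hcap := objE_capChord_mul (k := 5) (by norm_num : (0 : ℝ) ≤ 5) (by norm_num) (by norm_num) (by norm_num) ca cb hn1 (by linarith) (by norm_num)
  rcases le_or_gt t' (-7 / 20) with hp0 | hp0
  · -- piece `[-17/40, -7/20]`, columns `-9/20`, `-7/20`
    have ra := fermiSeaTangentRow_tPrime_neg_nine_div_twenty_at_seven_div_eight (U := 0) le_rfl hn0 hn2'
    have rb := fermiSeaTangentRow_tPrime_neg_seven_div_twenty_at_seven_div_eight (U := 0) le_rfl hn0 hn2'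
    have hfl := objE_floorChord_mul (s := t') (k := 10) hn0 hn2' (by norm_num : (-9 / 20 : ℝ) < -7 / 20) ra rb (by linarith) hp0 (by norm_num)
    exact doccN_lt_of_capUc_threshold (U₁ := 5) (Uc := 5) (by norm_num) (by norm_num) hU hn0 hn2' hcap hfl
      (by nlinarith only [mul_nonneg (sub_nonneg.2 hn1) (sub_nonneg.2 ht1), mul_nonneg (sub_nonneg.2 hn1) (sub_nonneg.2 hp0), mul_nonneg (sub_nonneg.2 hn2) (sub_nonneg.2 ht1), mul_nonneg (sub_nonneg.2 hn2) (sub_nonneg.2 hp0), hsqU])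
  · -- `t' > -7/20`
    have ra := fermiSeaTangentRow_tPrime_neg_seven_div_twenty_at_seven_div_eight (U := 0) le_rfl hn0 hn2'
    have rb := fermiSeaTangentRow_tPrime_neg_three_div_ten_at_seven_div_eight (U := 0) le_rfl hn0 hn2'
    have hfl := objE_floorChord_mul (s := t') (k := 20) hn0 hn2' (by norm_num : (-7 / 20 : ℝ) < -3 / 10) ra rb hp0.le (by linarith) (by norm_num)
    exact doccN_lt_of_capUc_threshold (U₁ := 5) (Uc := 5) (by norm_num) (by norm_num) hU hn0 hn2' hcap hfl
      (by nlinarith only [mul_nonneg (sub_nonneg.2 hn1) (sub_nonneg.2 hp0.le), mul_nonneg (sub_nonneg.2 hn1) (sub_nonneg.2 ht2), mul_nonneg (sub_nonneg.2 hn2) (sub_nonneg.2 hp0.le), mul_nonneg (sub_nonneg.2 hn2) (sub_nonneg.2 ht2), hsqU])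

/-- **Tl₂Ba₂CuO₆₊δ overdoped p = 0.26 (VSET 34b), object E, `n ∈ [0.70, 0.78]`, `t' ∈ [-17/40, -81/250]` × `n ∈ [7/10, 39/50]` — MF/BCS class excluded at EVERY `U ≥ 9/2`, HYPOTHESIS-FREE** (box `U/t_eff ∈ [3.19, 8.20]`; supersedes for coverage the conditional `tlP_od26_docc_lt (round 1) ⊂ tlE_od26_docc_lt_of (U ≥ 7.5; #445 ∧ #473)`). Every GS torus limit has `Re ω(n_{0↑}n_{0↓}) < (n/2)²`. Cap at `U_c = 5` = density chord from the polarised-sea plane at `n = 7/10` to the kernel AF-HF half-filling cap `afhfCap_n1_U5_at` (tail: monotone below `U_c`, HF slope above); floor = `t'`-chords of the kernel Fermi-sea columns `-9/20 | -7/20 | -3/10` (touch `3/4 | 3/4 | 3/4`); exact piece margins `+0.0239`, `+0.0126`. [cite: BachLiebSolovej1994, eq. (2c.36)] [cite: KomaTasaki1994, §1] [cite: LiebLoss1993, §8, Theorem 8.2] -/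
theorem tlP_od26_docc_lt_v2 {t' U n : ℝ} (ht1 : -17 / 40 ≤ t') (ht2 : t' ≤ -81 / 250) (hU : 9 / 2 ≤ U)
    (hn1 : 7 / 10 ≤ n) (hn2 : n ≤ 39 / 50) :
    ∀ (ω : InfVolFermionState 2) (Ls : ℕ → ℕ) (ψ : ∀ L, Fock (Orb (FermionTorus 2 L))),
      Tendsto Ls atTop atTop →
      (∀ j, IsGroundStateInSector (hubbardTorusTT' (Ls j) 1 t' U) (rectN n (Ls j)) 0 (ψ (Ls j))) →
      (∀ j, star (ψ (Ls j)) ⬝ᵥ ψ (Ls j) = 1) → ω.IsTorusLimitOf ψ Ls →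
      (ω.expect ({0} : Finset (Site 2))
        (nAt 0 (Finset.mem_singleton_self 0) 0 * nAt 0 (Finset.mem_singleton_self 0) 1)).re < (n / 2) ^ 2 := by
  have hn0 : (0 : ℝ) ≤ n := by linarith
  have hn2' : n < 2 := by linarith
  have hsq : (-49 / 400 : ℝ) + 7 / 20 * n ≤ (n / 2) ^ 2 := by nlinarith [sq_nonneg (n - 7 / 10)]
  have hsqU : ((-49 / 400 : ℝ) + 7 / 20 * n) * (9 / 2) ≤ (n / 2) ^ 2 * (9 / 2) :=
    mul_le_mul_of_nonneg_right hsq (by norm_num)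
  -- CAP at `U_c = 5`: density chord from the polarised-sea plane at `n = 7/10` to the kernel AF-Hartree–Fock half-filling cap
  have ca := tlP34b_polCap_n7000 (by norm_num : (0 : ℝ) ≤ 5) ht1 ht2
  have cb := afhfCap_n1_U5_at t' (by norm_num : (0 : ℝ) ≤ 5) le_rfl
  have hcap := objE_capChord_mul (k := 10 / 3) (by norm_num : (0 : ℝ) ≤ 5) (by norm_num) (by norm_num) (by norm_num) ca cb hn1 (by linarith) (by norm_num)
  rcases le_or_gt t' (-7 / 20) with hp0 | hp0
  · -- piece `[-17/40, -7/20]`, columns `-9/20`, `-7/20`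
    have ra := fermiSeaTangentRow_tPrime_neg_nine_div_twenty_at_three_div_four (U := 0) le_rfl hn0 hn2'
    have rb := fermiSeaTangentRow_tPrime_neg_seven_div_twenty_at_three_div_four (U := 0) le_rfl hn0 hn2'
    have hfl := objE_floorChord_mul (s := t') (k := 10) hn0 hn2' (by norm_num : (-9 / 20 : ℝ) < -7 / 20) ra rb (by linarith) hp0 (by norm_num)
    exact doccN_lt_of_capUc_threshold (U₁ := 9 / 2) (Uc := 5) (by norm_num) (by norm_num) hU hn0 hn2' hcap hfl
      (by nlinarith only [mul_nonneg (sub_nonneg.2 hn1) (sub_nonneg.2 ht1), mul_nonneg (sub_nonneg.2 hn1) (sub_nonneg.2 hp0), mul_nonneg (sub_nonneg.2 hn2) (sub_nonneg.2 ht1), mul_nonneg (sub_nonneg.2 hn2) (sub_nonneg.2 hp0), hsqU])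
  · -- `t' > -7/20`
    have ra := fermiSeaTangentRow_tPrime_neg_seven_div_twenty_at_three_div_four (U := 0) le_rfl hn0 hn2'
    have rb := fermiSeaTangentRow_tPrime_neg_three_div_ten_at_three_div_four (U := 0) le_rfl hn0 hn2'
    have hfl := objE_floorChord_mul (s := t') (k := 20) hn0 hn2' (by norm_num : (-7 / 20 : ℝ) < -3 / 10) ra rb hp0.le (by linarith) (by norm_num)
    exact doccN_lt_of_capUc_threshold (U₁ := 9 / 2) (Uc := 5) (by norm_num) (by norm_num) hU hn0 hn2' hcap hfl
      (by nlinarith only [mul_nonneg (sub_nonneg.2 hn1) (sub_nonneg.2 hp0.le), mul_nonneg (sub_nonneg.2 hn1) (sub_nonneg.2 ht2), mul_nonneg (sub_nonneg.2 hn2) (sub_nonneg.2 hp0.le), mul_nonneg (sub_nonneg.2 hn2) (sub_nonneg.2 ht2), hsqU])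

/-- **YBa₂Cu₃O₆.₉₂ BOX OF RECORD #106 object E (M18; P = 0 `[4.7, 11.4] × [−0.63, −0.44]`, P = 2 GPa `[4.4, 12.0] × [−0.65, −0.42]`, `n(plane) ∈ [0.81, 0.92]`), `t' ∈ [-13/20, -21/50]` × `n ∈ [7/8, 23/25]` — MF/BCS class excluded at EVERY `U ≥ 11/2`, HYPOTHESIS-FREE** (box `U/t_eff ∈ @0 [4.7, 11.4] / @2 [4.4, 12.0]`; supersedes for coverage the conditional `ybco106E_highBand_docc_lt (round 1) ⊂ U ≥ 6`). Every GS torus limit has `Re ω(n_{0↑}n_{0↓}) < (n/2)²`. Cap at `U_c = 6` = density chord from the polarised-sea plane at `n = 7/8` to the kernel AF-HF half-filling cap `afhfCap_n1_U6_at` (tail: monotone below `U_c`, HF slope above); floor = `t'`-chords of the kernel Fermi-sea columns `-13/20 | -113/200 | -1/2 | -2/5` (touch `9/10 | 9/10 | 9/10 | 9/10`); exact piece margins `+0.0420`, `+0.0420`, `+0.0269`. [cite: BachLiebSolovej1994, eq. (2c.36)] [cite: KomaTasaki1994, §1] [cite: LiebLoss1993, §8, Theorem 8.2] -/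
theorem ybco106E_highBand_docc_lt_v2 {t' U n : ℝ} (ht1 : -13 / 20 ≤ t') (ht2 : t' ≤ -21 / 50) (hU : 11 / 2 ≤ U)
    (hn1 : 7 / 8 ≤ n) (hn2 : n ≤ 23 / 25) :
    ∀ (ω : InfVolFermionState 2) (Ls : ℕ → ℕ) (ψ : ∀ L, Fock (Orb (FermionTorus 2 L))),
      Tendsto Ls atTop atTop →
      (∀ j, IsGroundStateInSector (hubbardTorusTT' (Ls j) 1 t' U) (rectN n (Ls j)) 0 (ψ (Ls j))) →
      (∀ j, star (ψ (Ls j)) ⬝ᵥ ψ (Ls j) = 1) → ω.IsTorusLimitOf ψ Ls →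
      (ω.expect ({0} : Finset (Site 2))
        (nAt 0 (Finset.mem_singleton_self 0) 0 * nAt 0 (Finset.mem_singleton_self 0) 1)).re < (n / 2) ^ 2 := by
  have hn0 : (0 : ℝ) ≤ n := by linarith
  have hn2' : n < 2 := by linarith
  have hsq : (-49 / 256 : ℝ) + 7 / 16 * n ≤ (n / 2) ^ 2 := by nlinarith [sq_nonneg (n - 7 / 8)]
  have hsqU : ((-49 / 256 : ℝ) + 7 / 16 * n) * (11 / 2) ≤ (n / 2) ^ 2 * (11 / 2) :=
    mul_le_mul_of_nonneg_right hsq (by norm_num)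
  -- CAP at `U_c = 6`: density chord from the polarised-sea plane at `n = 7/8` to the kernel AF-Hartree–Fock half-filling cap
  have ca := ybco106_polCap_n0875 (by norm_num : (0 : ℝ) ≤ 6) ht1 ht2
  have cb := afhfCap_n1_U6_at t' (by norm_num : (0 : ℝ) ≤ 6) le_rfl
  have hcap := objE_capChord_mul (k := 8) (by norm_num : (0 : ℝ) ≤ 6) (by norm_num) (by norm_num) (by norm_num) ca cb hn1 (by linarith) (by norm_num)
  rcases le_or_gt t' (-113 / 200) with hp0 | hp0
  · -- piece `[-13/20, -113/200]`, columns `-13/20`, `-113/200`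
    have ra := fermiSeaRow4_tPrime_neg_thirteen_div_twenty_at_nine_div_ten (U := 0) le_rfl hn0 hn2'
    have rb := fermiSeaRow4_tPrime_neg_hundredthirteen_div_twohundred_at_nine_div_ten (U := 0) le_rfl hn0 hn2'
    have hfl := objE_floorChord_mul (s := t') (k := 200 / 17) hn0 hn2' (by norm_num : (-13 / 20 : ℝ) < -113 / 200) ra rb ht1 hp0 (by norm_num)
    exact doccN_lt_of_capUc_threshold (U₁ := 11 / 2) (Uc := 6) (by norm_num) (by norm_num) hU hn0 hn2' hcap hfl
      (by nlinarith only [mul_nonneg (sub_nonneg.2 hn1) (sub_nonneg.2 ht1), mul_nonneg (sub_nonneg.2 hn1) (sub_nonneg.2 hp0), mul_nonneg (sub_nonneg.2 hn2) (sub_nonneg.2 ht1), mul_nonneg (sub_nonneg.2 hn2) (sub_nonneg.2 hp0), hsqU])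
  · -- `t' > -113/200`
    rcases le_or_gt t' (-1 / 2) with hp1 | hp1
    · -- piece `[-113/200, -1/2]`, columns `-113/200`, `-1/2`
      have ra := fermiSeaRow4_tPrime_neg_hundredthirteen_div_twohundred_at_nine_div_ten (U := 0) le_rfl hn0 hn2'
      have rb := fermiSeaTangentRow_tPrime_neg_one_div_two_at_nine_div_ten (U := 0) le_rfl hn0 hn2'
      have hfl := objE_floorChord_mul (s := t') (k := 200 / 13) hn0 hn2' (by norm_num : (-113 / 200 : ℝ) < -1 / 2) ra rb hp0.le hp1 (by norm_num)
      exact doccN_lt_of_capUc_threshold (U₁ := 11 / 2) (Uc := 6) (by norm_num) (by norm_num) hU hn0 hn2' hcap hfl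
        (by nlinarith only [mul_nonneg (sub_nonneg.2 hn1) (sub_nonneg.2 hp0.le), mul_nonneg (sub_nonneg.2 hn1) (sub_nonneg.2 hp1), mul_nonneg (sub_nonneg.2 hn2) (sub_nonneg.2 hp0.le), mul_nonneg (sub_nonneg.2 hn2) (sub_nonneg.2 hp1), hsqU])
    · -- `t' > -1/2`
      have ra := fermiSeaTangentRow_tPrime_neg_one_div_two_at_nine_div_ten (U := 0) le_rfl hn0 hn2'
      have rb := fermiSeaTangentRow_tPrime_neg_two_div_five_at_nine_div_ten (U := 0) le_rfl hn0 hn2'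
      have hfl := objE_floorChord_mul (s := t') (k := 10) hn0 hn2' (by norm_num : (-1 / 2 : ℝ) < -2 / 5) ra rb hp1.le (by linarith) (by norm_num)
      exact doccN_lt_of_capUc_threshold (U₁ := 11 / 2) (Uc := 6) (by norm_num) (by norm_num) hU hn0 hn2' hcap hfl
        (by nlinarith only [mul_nonneg (sub_nonneg.2 hn1) (sub_nonneg.2 hp1.le), mul_nonneg (sub_nonneg.2 hn1) (sub_nonneg.2 ht2), mul_nonneg (sub_nonneg.2 hn2) (sub_nonneg.2 hp1.le), mul_nonneg (sub_nonneg.2 hn2) (sub_nonneg.2 ht2), hsqU])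

/-- **YBa₂Cu₃O₆.₉₂ BOX OF RECORD #106 object E (M18; P = 0 `[4.7, 11.4] × [−0.63, −0.44]`, P = 2 GPa `[4.4, 12.0] × [−0.65, −0.42]`, `n(plane) ∈ [0.81, 0.92]`), `t' ∈ [-13/20, -21/50]` × `n ∈ [81/100, 7/8]` — MF/BCS class excluded at EVERY `U ≥ 24/5`, HYPOTHESIS-FREE** (box `U/t_eff ∈ @0 [4.7, 11.4] / @2 [4.4, 12.0]`; supersedes for coverage the conditional `ybco106E_lowBand_docc_lt (round 1) ⊂ U ≥ 11/2`). Every GS torus limit has `Re ω(n_{0↑}n_{0↓}) < (n/2)²`. Cap at `U_c = 5` = density chord from the polarised-sea plane at `n = 81/100` to the kernel AF-HF half-filling cap `afhfCap_n1_U5_at` (tail: monotone below `U_c`, HF slope above); floor = `t'`-chords of the kernel Fermi-sea columns `-13/20 | -113/200 | -1/2 | -2/5` (touch `33/40 | 33/40 | 21/25 | 21/25`); exact piece margins `+0.0466`, `+0.0408`, `+0.0138`. [cite: BachLiebSolovej1994, eq. (2c.36)] [cite: KomaTasaki1994, §1] [cite: LiebLoss1993, §8, Theorem 8.2] -/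
theorem ybco106E_lowBand_docc_lt_v2 {t' U n : ℝ} (ht1 : -13 / 20 ≤ t') (ht2 : t' ≤ -21 / 50) (hU : 24 / 5 ≤ U)
    (hn1 : 81 / 100 ≤ n) (hn2 : n ≤ 7 / 8) :
    ∀ (ω : InfVolFermionState 2) (Ls : ℕ → ℕ) (ψ : ∀ L, Fock (Orb (FermionTorus 2 L))),
      Tendsto Ls atTop atTop →
      (∀ j, IsGroundStateInSector (hubbardTorusTT' (Ls j) 1 t' U) (rectN n (Ls j)) 0 (ψ (Ls j))) →
      (∀ j, star (ψ (Ls j)) ⬝ᵥ ψ (Ls j) = 1) → ω.IsTorusLimitOf ψ Ls →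
      (ω.expect ({0} : Finset (Site 2))
        (nAt 0 (Finset.mem_singleton_self 0) 0 * nAt 0 (Finset.mem_singleton_self 0) 1)).re < (n / 2) ^ 2 := by
  have hn0 : (0 : ℝ) ≤ n := by linarith
  have hn2' : n < 2 := by linarith
  have hsq : (-6561 / 40000 : ℝ) + 81 / 200 * n ≤ (n / 2) ^ 2 := by nlinarith [sq_nonneg (n - 81 / 100)]
  have hsqU : ((-6561 / 40000 : ℝ) + 81 / 200 * n) * (24 / 5) ≤ (n / 2) ^ 2 * (24 / 5) :=
    mul_le_mul_of_nonneg_right hsq (by norm_num)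
  -- CAP at `U_c = 5`: density chord from the polarised-sea plane at `n = 81/100` to the kernel AF-Hartree–Fock half-filling cap
  have ca := ybco106_polCap_n0810 (by norm_num : (0 : ℝ) ≤ 5) ht1 ht2
  have cb := afhfCap_n1_U5_at t' (by norm_num : (0 : ℝ) ≤ 5) le_rfl
  have hcap := objE_capChord_mul (k := 100 / 19) (by norm_num : (0 : ℝ) ≤ 5) (by norm_num) (by norm_num) (by norm_num) ca cb hn1 (by linarith) (by norm_num)
  rcases le_or_gt t' (-113 / 200) with hp0 | hp0
  · -- piece `[-13/20, -113/200]`, columns `-13/20`, `-113/200`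
    have ra := fermiSeaRow4_tPrime_neg_thirteen_div_twenty_at_thirtythree_div_forty (U := 0) le_rfl hn0 hn2'
    have rb := fermiSeaRow4_tPrime_neg_hundredthirteen_div_twohundred_at_thirtythree_div_forty (U := 0) le_rfl hn0 hn2'
    have hfl := objE_floorChord_mul (s := t') (k := 200 / 17) hn0 hn2' (by norm_num : (-13 / 20 : ℝ) < -113 / 200) ra rb ht1 hp0 (by norm_num)
    exact doccN_lt_of_capUc_threshold (U₁ := 24 / 5) (Uc := 5) (by norm_num) (by norm_num) hU hn0 hn2' hcap hfl
      (by nlinarith only [mul_nonneg (sub_nonneg.2 hn1) (sub_nonneg.2 ht1), mul_nonneg (sub_nonneg.2 hn1) (sub_nonneg.2 hp0), mul_nonneg (sub_nonneg.2 hn2) (sub_nonneg.2 ht1), mul_nonneg (sub_nonneg.2 hn2) (sub_nonneg.2 hp0), hsqU])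
  · -- `t' > -113/200`
    rcases le_or_gt t' (-1 / 2) with hp1 | hp1
    · -- piece `[-113/200, -1/2]`, columns `-113/200`, `-1/2`
      have ra := fermiSeaRow4_tPrime_neg_hundredthirteen_div_twohundred_at_thirtythree_div_forty (U := 0) le_rfl hn0 hn2'
      have rb := fermiSeaTangentRow_tPrime_neg_one_div_two_at_twentyone_div_twentyfive (U := 0) le_rfl hn0 hn2'
      have hfl := objE_floorChord_mul (s := t') (k := 200 / 13) hn0 hn2' (by norm_num : (-113 / 200 : ℝ) < -1 / 2) ra rb hp0.le hp1 (by norm_num)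
      exact doccN_lt_of_capUc_threshold (U₁ := 24 / 5) (Uc := 5) (by norm_num) (by norm_num) hU hn0 hn2' hcap hfl
        (by nlinarith only [mul_nonneg (sub_nonneg.2 hn1) (sub_nonneg.2 hp0.le), mul_nonneg (sub_nonneg.2 hn1) (sub_nonneg.2 hp1), mul_nonneg (sub_nonneg.2 hn2) (sub_nonneg.2 hp0.le), mul_nonneg (sub_nonneg.2 hn2) (sub_nonneg.2 hp1), hsqU])
    · -- `t' > -1/2`
      have ra := fermiSeaTangentRow_tPrime_neg_one_div_two_at_twentyone_div_twentyfive (U := 0) le_rfl hn0 hn2'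
      have rb := fermiSeaTangentRow_tPrime_neg_two_div_five_at_twentyone_div_twentyfive (U := 0) le_rfl hn0 hn2'
      have hfl := objE_floorChord_mul (s := t') (k := 10) hn0 hn2' (by norm_num : (-1 / 2 : ℝ) < -2 / 5) ra rb hp1.le (by linarith) (by norm_num)
      exact doccN_lt_of_capUc_threshold (U₁ := 24 / 5) (Uc := 5) (by norm_num) (by norm_num) hU hn0 hn2' hcap hfl
        (by nlinarith only [mul_nonneg (sub_nonneg.2 hn1) (sub_nonneg.2 hp1.le), mul_nonneg (sub_nonneg.2 hn1) (sub_nonneg.2 ht2), mul_nonneg (sub_nonneg.2 hn2) (sub_nonneg.2 hp1.le), mul_nonneg (sub_nonneg.2 hn2) (sub_nonneg.2 ht2), hsqU])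

/-- **YBa₂Cu₃O₆.₉₂ BOX OF RECORD #106 object E (M18; P = 0 `[4.7, 11.4] × [−0.63, −0.44]`, P = 2 GPa `[4.4, 12.0] × [−0.65, −0.42]`, `n(plane) ∈ [0.81, 0.92]`), `t' ∈ [-13/20, -21/50]` × `n ∈ [79/100, 81/100]` — MF/BCS class excluded at EVERY `U ≥ 23/5`, HYPOTHESIS-FREE** (box `U/t_eff ∈ @0 [4.7, 11.4] / @2 [4.4, 12.0]`; supersedes for coverage the conditional `ybco106E_lowN_docc_lt (round 1) ⊂ U ≥ 24/5`). Every GS torus limit has `Re ω(n_{0↑}n_{0↓}) < (n/2)²`. Cap at `U_c = 5` = density chord from the polarised-sea plane at `n = 79/100` to the kernel AF-HF half-filling cap `afhfCap_n1_U5_at` (tail: monotone below `U_c`, HF slope above); floor = `t'`-chords of the kernel Fermi-sea columns `-13/20 | -113/200 | -1/2 | -2/5` (touch `4/5 | 4/5 | 3/4 | 3/4`); exact piece margins `+0.0471`, `+0.0367`, `+0.0105`. [cite: BachLiebSolovej1994, eq. (2c.36)] [cite: KomaTasaki1994, §1] [cite: LiebLoss1993, §8, Theorem 8.2] -/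
theorem ybco106E_lowN_docc_lt_v2 {t' U n : ℝ} (ht1 : -13 / 20 ≤ t') (ht2 : t' ≤ -21 / 50) (hU : 23 / 5 ≤ U)
    (hn1 : 79 / 100 ≤ n) (hn2 : n ≤ 81 / 100) :
    ∀ (ω : InfVolFermionState 2) (Ls : ℕ → ℕ) (ψ : ∀ L, Fock (Orb (FermionTorus 2 L))),
      Tendsto Ls atTop atTop →
      (∀ j, IsGroundStateInSector (hubbardTorusTT' (Ls j) 1 t' U) (rectN n (Ls j)) 0 (ψ (Ls j))) →
      (∀ j, star (ψ (Ls j)) ⬝ᵥ ψ (Ls j) = 1) → ω.IsTorusLimitOf ψ Ls →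
      (ω.expect ({0} : Finset (Site 2))
        (nAt 0 (Finset.mem_singleton_self 0) 0 * nAt 0 (Finset.mem_singleton_self 0) 1)).re < (n / 2) ^ 2 := by
  have hn0 : (0 : ℝ) ≤ n := by linarith
  have hn2' : n < 2 := by linarith
  have hsq : (-6241 / 40000 : ℝ) + 79 / 200 * n ≤ (n / 2) ^ 2 := by nlinarith [sq_nonneg (n - 79 / 100)]
  have hsqU : ((-6241 / 40000 : ℝ) + 79 / 200 * n) * (23 / 5) ≤ (n / 2) ^ 2 * (23 / 5) :=
    mul_le_mul_of_nonneg_right hsq (by norm_num)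
  -- CAP at `U_c = 5`: density chord from the polarised-sea plane at `n = 79/100` to the kernel AF-Hartree–Fock half-filling cap
  have ca := ybco106_polCap_n0790 (by norm_num : (0 : ℝ) ≤ 5) ht1 ht2
  have cb := afhfCap_n1_U5_at t' (by norm_num : (0 : ℝ) ≤ 5) le_rfl
  have hcap := objE_capChord_mul (k := 100 / 21) (by norm_num : (0 : ℝ) ≤ 5) (by norm_num) (by norm_num) (by norm_num) ca cb hn1 (by linarith) (by norm_num)
  rcases le_or_gt t' (-113 / 200) with hp0 | hp0
  · -- piece `[-13/20, -113/200]`, columns `-13/20`, `-113/200`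
    have ra := fermiSeaRow4_tPrime_neg_thirteen_div_twenty_at_four_div_five (U := 0) le_rfl hn0 hn2'
    have rb := fermiSeaRow4_tPrime_neg_hundredthirteen_div_twohundred_at_four_div_five (U := 0) le_rfl hn0 hn2'
    have hfl := objE_floorChord_mul (s := t') (k := 200 / 17) hn0 hn2' (by norm_num : (-13 / 20 : ℝ) < -113 / 200) ra rb ht1 hp0 (by norm_num)
    exact doccN_lt_of_capUc_threshold (U₁ := 23 / 5) (Uc := 5) (by norm_num) (by norm_num) hU hn0 hn2' hcap hfl
      (by nlinarith only [mul_nonneg (sub_nonneg.2 hn1) (sub_nonneg.2 ht1), mul_nonneg (sub_nonneg.2 hn1) (sub_nonneg.2 hp0), mul_nonneg (sub_nonneg.2 hn2) (sub_nonneg.2 ht1), mul_nonneg (sub_nonneg.2 hn2) (sub_nonneg.2 hp0), hsqU])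
  · -- `t' > -113/200`
    rcases le_or_gt t' (-1 / 2) with hp1 | hp1
    · -- piece `[-113/200, -1/2]`, columns `-113/200`, `-1/2`
      have ra := fermiSeaRow4_tPrime_neg_hundredthirteen_div_twohundred_at_four_div_five (U := 0) le_rfl hn0 hn2'
      have rb := fermiSeaTangentRow_tPrime_neg_one_div_two_at_three_div_four (U := 0) le_rfl hn0 hn2'
      have hfl := objE_floorChord_mul (s := t') (k := 200 / 13) hn0 hn2' (by norm_num : (-113 / 200 : ℝ) < -1 / 2) ra rb hp0.le hp1 (by norm_num)
      exact doccN_lt_of_capUc_threshold (U₁ := 23 / 5) (Uc := 5) (by norm_num) (by norm_num) hU hn0 hn2' hcap hfl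
        (by nlinarith only [mul_nonneg (sub_nonneg.2 hn1) (sub_nonneg.2 hp0.le), mul_nonneg (sub_nonneg.2 hn1) (sub_nonneg.2 hp1), mul_nonneg (sub_nonneg.2 hn2) (sub_nonneg.2 hp0.le), mul_nonneg (sub_nonneg.2 hn2) (sub_nonneg.2 hp1), hsqU])
    · -- `t' > -1/2`
      have ra := fermiSeaTangentRow_tPrime_neg_one_div_two_at_three_div_four (U := 0) le_rfl hn0 hn2'
      have rb := fermiSeaTangentRow_tPrime_neg_two_div_five_at_three_div_four (U := 0) le_rfl hn0 hn2'
      have hfl := objE_floorChord_mul (s := t') (k := 10) hn0 hn2' (by norm_num : (-1 / 2 : ℝ) < -2 / 5) ra rb hp1.le (by linarith) (by norm_num)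
      exact doccN_lt_of_capUc_threshold (U₁ := 23 / 5) (Uc := 5) (by norm_num) (by norm_num) hU hn0 hn2' hcap hfl
        (by nlinarith only [mul_nonneg (sub_nonneg.2 hn1) (sub_nonneg.2 hp1.le), mul_nonneg (sub_nonneg.2 hn1) (sub_nonneg.2 ht2), mul_nonneg (sub_nonneg.2 hn2) (sub_nonneg.2 hp1.le), mul_nonneg (sub_nonneg.2 hn2) (sub_nonneg.2 ht2), hsqU])

end Summit.Ventures.CertifiedManyBodySolver.Observables

end
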